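import Literature.AlgebraicGeometry.Motives.HodgeLieTimesLowRankGeneric
import Literature.AlgebraicGeometry.Motives.HodgeLieOfAbelianVarietySemisimpleTimesCM
import Literature.AlgebraicGeometry.HodgeTheory.TimesNonCMCurveInvariance
import Literature.AlgebraicGeometry.HodgeTheory.TimesNonCMCurveProductSpan
import Summits.HodgeConjecture.CorCM.MumfordTateRankThreefolds
import Summits.HodgeConjecture.CorCM.MumfordTateRankSimpleSurfacesSharp
import Summits.HodgeConjecture.CorCM.MumfordTateRankEllipticProducts
import Literature.AlgebraicGeometry.Milne1999.SpecialLefschetzGroupInvariantsCMType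
import HarnessLib

/-!
# `dim MT(H¹(A × S)) + 1 = dim MT(H¹A) + dim MT(H¹S)` for EVERY `A` and every `S` of dimension `≤ 3` with `End⁰S = ℚ` and `Hom(A, S) = 0`
# (Moonen–Zarhin 1999 Lemma (3.4) with (2.4)(3): `Hg(A × S) = Hg(A) × Sp_{2g}`); `ℚ × ℚ′` surfaces `t = 21`, threefold cells `+ 21`

COR-CM (cell `pub-hodgecm2`, seat `b27` gen 47, count-neutral Mumford–Tate-rank ladder; theorems only, no definition, no named fact;
UNCONDITIONAL — nothing here uses or asserts HC_CM).  The complex-abelian-variety reading of `Motives/HodgeLieTimesLowRankGeneric` (which applies the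
abstract Lemma (3.4) of cell `pub-hodge-ring2`, `goursat_incl_corner_mem_of_hom_eq_zero_of_rigid`, to `hodgeLie`): for a curve, surface or
threefold `S` with `End⁰S = ℚ` (`Hg(S) = Sp_{2g}`, `t(S) = 4, 11, 22`) and ANY `A` with `Hom(A, S) = 0`,

* **`mtRank_hodge_one_add_one_eq_add_of_isIsogenous_prod_endRankOne`** — `t(X) + 1 = t(A) + t(S)` for `X ∼ A × S`, i.e. `t(X) = t(A) + g(2g+1)`;
* **`mtRank_hodge_one_eq_twentyone_of_isIsogenous_prod_surfaces_endRankOne`** — two NON-isogenous surfaces with `End⁰ = ℚ`: `t = 21`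
  (`Hg = Sp₄ × Sp₄`; the cell left open by `CorCM/MumfordTateRankSurfaceTimesSurface`);
* **`mtRank_hodge_one_eq_add_of_isIsogenous_prod_threefold_endRankOne`** — `t(A × T) = t(A) + 21` for a threefold `T` with `End⁰T = ℚ` and
  `Hom(A, T) = 0`; two non-isogenous such threefolds: `t = 43`.

## References
* [MoonenZarhin1999LowDim] B. Moonen, Yu. G. Zarhin, *Hodge classes on abelian varieties of low dimension*, Math. Ann. 315 (1999),
  §2 (2.4)(3), §3 (3.1), Lemma (3.4), §5 (5.4) [corpus: paper:arxiv-math_9901113 pp. 5–7]. [cite: MoonenZarhin1999LowDim, §3 Lemma (3.4)]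
* [DeligneMilne1982Tannakian] P. Deligne, J. S. Milne, LNM 900 (1982), §6 Thm. 6.20. [cite: DeligneMilne1982Tannakian, §6 Thm. 6.20]
-/

noncomputable section

open scoped TensorProduct
open CategoryTheory CategoryTheory.Limits Module

namespace Summit.HodgeConjecture.CorCM

open Literature.AlgebraicGeometry.Motives
open Literature.AlgebraicGeometry.Motives.AbelianVariety
open Literature.AlgebraicGeometry.Motives.HodgeStructure
open Literature.AlgebraicGeometry.HodgeTheory
open Literature.AlgebraicGeometry.Milne1999 (IsOfCMType)

variable [HodgeTensorFacts.{0, 0}] {X : AbelianVariety ℂ} {n : ℕ}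

/-! ## §1 `dim Lie Hg(H¹(A × S)) = dim Lie Hg(H¹A) + dim Lie Hg(H¹S)` -/

/-- **`dim Lie Hg(H¹(A × S)) = dim Lie Hg(H¹A) + dim Lie Hg(H¹S)` for `S` of dimension `1`, `2` or `3` with `End⁰S = ℚ` and `Hom(A, S) = 0`**
(Moonen–Zarhin Lemma (3.4) with (2.4)(3): `Hg(A × S) = Hg(A) × Sp_{2g}`; `Lie Hg(H¹S) = 𝔰𝔭(H¹S, ψ)`).
[cite: MoonenZarhin1999LowDim, §3 Lemma (3.4)] [cite: DeligneMilne1982Tannakian, §6 Thm. 6.20] -/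
theorem finrank_hodgeLie_hodge_one_prod_endRankOne_eq_add {A S : AbelianVariety ℂ} (hS : S.dim = 1 ∨ S.dim = 2 ∨ S.dim = 3)
    (hSE : Module.finrank ℚ S.endAlgebra = 1) (hAS : ∀ u : A ⟶ S, u = 0) {m : ℕ} (hP : IsSmoothProjective m (A.prod S).X) :
    haveI := BettiUniverse.finite hP 1
    haveI := BettiUniverse.finite (AbelianVariety.isSmoothProjective_holds (A := A)) 1
    haveI := BettiUniverse.finite (AbelianVariety.isSmoothProjective_holds (A := S)) 1
    Module.finrank ℚ (BettiUniverse.hodge exists_isReal_hodgeModel_holds hP 1).hodgeLie =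
      Module.finrank ℚ (BettiUniverse.hodge exists_isReal_hodgeModel_holds (AbelianVariety.isSmoothProjective_holds (A := A)) 1).hodgeLie +
        Module.finrank ℚ (BettiUniverse.hodge exists_isReal_hodgeModel_holds (AbelianVariety.isSmoothProjective_holds (A := S)) 1).hodgeLie := by
  classical
  have hA : IsSmoothProjective A.dim A.X := AbelianVariety.isSmoothProjective_holds
  have hSsp : IsSmoothProjective S.dim S.X := AbelianVariety.isSmoothProjective_holds
  haveI := BettiUniverse.finite hP 1
  haveI := BettiUniverse.finite hA 1
  haveI := BettiUniverse.finite hSsp 1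
  have hHD : exists_isReal_hodgeModel := exists_isReal_hodgeModel_holds
  have hI : hodgePQ_independent_of_hodgeModel := hodgePQ_independent_of_hodgeModel_holds
  let ι₁ := BettiUniverse.pullHodgeHom hHD hI hP hA (fst A S).hom.hom.hom 1
  let π₁ := BettiUniverse.pullHodgeHom hHD hI hA hP (prodLift (𝟙 A) (0 : A ⟶ S)).hom.hom.hom 1
  let ι₂ := BettiUniverse.pullHodgeHom hHD hI hP hSsp (snd A S).hom.hom.hom 1
  let π₂ := BettiUniverse.pullHodgeHom hHD hI hSsp hP (prodLift (0 : S ⟶ A) (𝟙 S)).hom.hom.hom 1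
  have hsumP : fst A S ≫ prodLift (𝟙 A) (0 : A ⟶ S) + snd A S ≫ prodLift (0 : S ⟶ A) (𝟙 S) = 𝟙 _ := by
    refine prod_hom_ext ?_ ?_
    · rw [Preadditive.add_comp, Category.assoc, Category.assoc, prodLift_fst, prodLift_fst, Category.comp_id,
        comp_zero, add_zero, Category.id_comp]
    · rw [Preadditive.add_comp, Category.assoc, Category.assoc, prodLift_snd, prodLift_snd, Category.comp_id,
        comp_zero, zero_add, Category.id_comp]
  have hπι₁ : ∀ v, π₁.toLinearMap (ι₁.toLinearMap v) = v := fun v => pull_pull_eq_self_of_comp_eq_id (prodLift_fst _ _) v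
  have hπι₂ : ∀ v, π₂.toLinearMap (ι₂.toLinearMap v) = v := fun v => pull_pull_eq_self_of_comp_eq_id (prodLift_snd _ _) v
  have hsum : ∀ v, ι₁.toLinearMap (π₁.toLinearMap v) + ι₂.toLinearMap (π₂.toLinearMap v) = v := fun v =>
    pull_pull_add_pull_pull_eq_self _ _ _ _ hsumP v
  obtain ⟨ψ₁⟩ := BettiUniverse.hodge_isPolarizable hHD hA 1
  obtain ⟨ψ₂⟩ := BettiUniverse.hodge_isPolarizable hHD hSsp 1
  have hE₂ := exists_eq_smul_one_of_finrank_endAlgebra_eq_one (A := S) hHD hI hSE (by omega)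
  have hV₂ : Module.finrank ℚ (bettiCohomology S.X 1) = 2 ∨ Module.finrank ℚ (bettiCohomology S.X 1) = 4 ∨
      Module.finrank ℚ (bettiCohomology S.X 1) = 6 := by
    rw [finrank_bettiCohomology_one S]; omega
  have hHom : ∀ f : bettiCohomology S.X 1 →ₗ[ℚ] bettiCohomology A.X 1,
      (∀ r : ℤ, ∀ x ∈ (BettiUniverse.hodge hHD hSsp 1).piece r (((1 : ℕ) : ℤ) - r),
        f.baseChange ℂ x ∈ (BettiUniverse.hodge hHD hA 1).piece r (((1 : ℕ) : ℤ) - r)) → f = 0 := by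
    intro f hf
    refine forall_isHodgeMorphismOne_eq_zero_of_forall_hom_eq_zero hAS f ⟨fun x hx => ?_, fun x hx => ?_⟩
    · have hx' := (BettiUniverse.mem_hodge_piece_iff hHD hI hSsp (k := 1) (p := 1) (q := 0) rfl _).2 hx
      have e : (((1 : ℕ) : ℤ) - 1) = 0 := by norm_num
      have h := hf 1 x (by rw [e]; exact hx')
      rw [e] at h
      exact (BettiUniverse.mem_hodge_piece_iff hHD hI hA (k := 1) (p := 1) (q := 0) rfl _).1 h
    · have hx' := (BettiUniverse.mem_hodge_piece_iff hHD hI hSsp (k := 1) (p := 0) (q := 1) rfl _).2 hx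
      have e : (((1 : ℕ) : ℤ) - 0) = 1 := by norm_num
      have h := hf 0 x (by rw [e]; exact hx')
      rw [e] at h
      exact (BettiUniverse.mem_hodge_piece_iff hHD hI hA (k := 1) (p := 0) (q := 1) rfl _).1 h
  have heff₁ := BettiUniverse.hodge_isEffective hHD hA 1
  have heff₂ := BettiUniverse.hodge_isEffective hHD hSsp 1
  have h := finrank_hodgeLie_eq_add_finrank_skewAdjoint_of_lowRankGeneric_summand ι₁ π₁ ι₂ π₂ hπι₁ hπι₂ hsum Nat.cast_one heff₁ heff₂
    ψ₁ ψ₂ hE₂ hV₂ hHom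
  obtain ⟨-, -, h2⟩ := block_incl₂_skewAdjoint_of_lowRankGeneric_summand ι₁ π₁ ι₂ π₂ hπι₁ hπι₂ hsum Nat.cast_one heff₁ heff₂ ψ₁ ψ₂ hE₂ hV₂ hHom
  rw [h, ← h2]

/-! ## §2 Mumford–Tate ranks -/

/-- **`t(X) + 1 = t(A) + t(S)` for every `X ∼ A × S` with `S` of dimension `≤ 3`, `End⁰S = ℚ` and `Hom(A, S) = 0`** (`0 < dim A`; `t(S) = 4, 11, 22`:
Moonen–Zarhin's `Hg(A × S) = Hg(A) × Sp_{2g}`, Lemma (3.4) with (2.4)(3), in dimensions; no hypothesis on `A`).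
[cite: MoonenZarhin1999LowDim, §3 Lemma (3.4)] [cite: DeligneMilne1982Tannakian, §6 Thm. 6.20] -/
theorem mtRank_hodge_one_add_one_eq_add_of_isIsogenous_prod_endRankOne (hX : IsSmoothProjective n X.X) {A S : AbelianVariety ℂ} {k l : ℕ}
    (hA : IsSmoothProjective k A.X) (hS : IsSmoothProjective l S.X) (hA0 : 0 < A.dim) (hS3 : S.dim = 1 ∨ S.dim = 2 ∨ S.dim = 3)
    (hSE : Module.finrank ℚ S.endAlgebra = 1) (hAS : ∀ u : A ⟶ S, u = 0) (hXP : IsIsogenous X (A.prod S)) :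
    haveI := BettiUniverse.finite hX 1
    haveI := BettiUniverse.finite hA 1
    haveI := BettiUniverse.finite hS 1
    (BettiUniverse.hodge exists_isReal_hodgeModel_holds hX 1).mtRank + 1 =
      (BettiUniverse.hodge exists_isReal_hodgeModel_holds hA 1).mtRank + (BettiUniverse.hodge exists_isReal_hodgeModel_holds hS 1).mtRank := by
  have hk : A.dim = k := schemeDim_eq_holds hA
  subst hk
  have hl : S.dim = l := schemeDim_eq_holds hS
  subst hl
  haveI := BettiUniverse.finite hX 1
  haveI := BettiUniverse.finite hA 1
  haveI := BettiUniverse.finite hS 1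
  have hP : IsSmoothProjective (A.prod S).dim (A.prod S).X := AbelianVariety.isSmoothProjective_holds
  haveI := BettiUniverse.finite hP 1
  have h0 : 0 < X.dim := by
    obtain ⟨g, hg⟩ := hXP; rw [dim_eq_of_isIsogeny hg, dim_prod]; omega
  have h := finrank_hodgeLie_hodge_one_prod_endRankOne_eq_add hS3 hSE hAS hP
  rw [← finrank_hodgeLie_hodge_one_eq_of_isIsogenous hX hP hXP] at h
  rw [mtRank_hodge_one_eq_finrank_hodgeLie_add_one hX h0, mtRank_hodge_one_eq_finrank_hodgeLie_add_one hA hA0,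
    mtRank_hodge_one_eq_finrank_hodgeLie_add_one hS (by omega)]
  omega

/-- The same with the factors swapped: `X ∼ S × A`. [cite: MoonenZarhin1999LowDim, §3 Lemma (3.4)] -/
theorem mtRank_hodge_one_add_one_eq_add_of_isIsogenous_endRankOne_prod (hX : IsSmoothProjective n X.X) {A S : AbelianVariety ℂ} {k l : ℕ}
    (hA : IsSmoothProjective k A.X) (hS : IsSmoothProjective l S.X) (hA0 : 0 < A.dim) (hS3 : S.dim = 1 ∨ S.dim = 2 ∨ S.dim = 3)
    (hSE : Module.finrank ℚ S.endAlgebra = 1) (hAS : ∀ u : A ⟶ S, u = 0) (hXP : IsIsogenous X (S.prod A)) :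
    haveI := BettiUniverse.finite hX 1
    haveI := BettiUniverse.finite hA 1
    haveI := BettiUniverse.finite hS 1
    (BettiUniverse.hodge exists_isReal_hodgeModel_holds hX 1).mtRank + 1 =
      (BettiUniverse.hodge exists_isReal_hodgeModel_holds hA 1).mtRank + (BettiUniverse.hodge exists_isReal_hodgeModel_holds hS 1).mtRank :=
  mtRank_hodge_one_add_one_eq_add_of_isIsogenous_prod_endRankOne hX hA hS hA0 hS3 hSE hAS (hXP.trans (isIsogenous_prod_comm S A))

/-! ## §3 Cells -/

/-- **Two NON-isogenous abelian surfaces with `End⁰ = ℚ`: `t(S × S′) = 21`** (`Hg = Sp₄ × Sp₄`, `t + 1 = 11 + 11`; `Hom(S, S′) = 0` for non-isogenous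
simple surfaces, and an `End⁰ = ℚ` surface is simple). [cite: MoonenZarhin1999LowDim, §2 (2.2) and §3 Lemma (3.4)] -/
theorem mtRank_hodge_one_eq_twentyone_of_isIsogenous_prod_surfaces_endRankOne (hX : IsSmoothProjective n X.X) {S S' : AbelianVariety ℂ}
    (hS2 : S.dim = 2) (hSE : Module.finrank ℚ S.endAlgebra = 1) (hS'2 : S'.dim = 2) (hS'E : Module.finrank ℚ S'.endAlgebra = 1)
    (hSS' : ¬ IsIsogenous S S') (hXP : IsIsogenous X (S.prod S')) :
    haveI := BettiUniverse.finite hX 1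
    (BettiUniverse.hodge exists_isReal_hodgeModel_holds hX 1).mtRank = 21 := by
  have hS : IsSmoothProjective S.dim S.X := AbelianVariety.isSmoothProjective_holds
  have hS' : IsSmoothProjective S'.dim S'.X := AbelianVariety.isSmoothProjective_holds
  haveI := BettiUniverse.finite hX 1
  haveI := BettiUniverse.finite hS 1
  haveI := BettiUniverse.finite hS' 1
  obtain ⟨h11, -⟩ := mtRank_hodge_one_eq_eleven_of_surface_of_finrank_endAlgebra_eq_one hS hS2 hSE
  obtain ⟨h11', -⟩ := mtRank_hodge_one_eq_eleven_of_surface_of_finrank_endAlgebra_eq_one hS' hS'2 hS'E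
  have hSs : S.IsSimple := (isSimple_and_finrank_endAlgebra_eq_one_of_surface_of_mtRank_eq_eleven hS hS2 h11).1
  have hS's : S'.IsSimple := (isSimple_and_finrank_endAlgebra_eq_one_of_surface_of_mtRank_eq_eleven hS' hS'2 h11').1
  have hHom : ∀ u : S ⟶ S', u = 0 := Literature.AlgebraicGeometry.Milne1999.hom_eq_zero_of_isSimple_of_not_isIsogenous hSs hS's hSS'
  have h := mtRank_hodge_one_add_one_eq_add_of_isIsogenous_prod_endRankOne hX hS hS' (by omega) (Or.inr (Or.inl hS'2)) hS'E hHom hXP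
  omega

/-- **`t(A × T) = t(A) + 21` for a threefold `T` with `End⁰T = ℚ` (`Hg(T) = Sp₆`, `t(T) = 22`) and ANY `A` with `Hom(A, T) = 0`.**
[cite: MoonenZarhin1999LowDim, §2 (2.3) and §3 Lemma (3.4)] -/
theorem mtRank_hodge_one_eq_add_of_isIsogenous_prod_threefold_endRankOne (hX : IsSmoothProjective n X.X) {A T : AbelianVariety ℂ} {k : ℕ}
    (hA : IsSmoothProjective k A.X) (hA0 : 0 < A.dim) (hT3 : T.dim = 3) (hTE : Module.finrank ℚ T.endAlgebra = 1)
    (hAT : ∀ u : A ⟶ T, u = 0) (hXP : IsIsogenous X (A.prod T)) :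
    haveI := BettiUniverse.finite hX 1
    haveI := BettiUniverse.finite hA 1
    (BettiUniverse.hodge exists_isReal_hodgeModel_holds hX 1).mtRank = (BettiUniverse.hodge exists_isReal_hodgeModel_holds hA 1).mtRank + 21 := by
  have hT : IsSmoothProjective T.dim T.X := AbelianVariety.isSmoothProjective_holds
  haveI := BettiUniverse.finite hX 1
  haveI := BettiUniverse.finite hA 1
  haveI := BettiUniverse.finite hT 1
  obtain ⟨h22, -⟩ := mtRank_hodge_one_eq_twentytwo_of_threefold_of_finrank_endAlgebra_eq_one hT hT3 hTE
  have h := mtRank_hodge_one_add_one_eq_add_of_isIsogenous_prod_endRankOne hX hA hT hA0 (Or.inr (Or.inr hT3)) hTE hAT hXP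
  omega

/-- **Two NON-isogenous abelian threefolds with `End⁰ = ℚ`: `t(T × T′) = 43`** (`Hg = Sp₆ × Sp₆`). [cite: MoonenZarhin1999LowDim, §2 (2.3) and §3 Lemma (3.4)] -/
theorem mtRank_hodge_one_eq_fortythree_of_isIsogenous_prod_threefolds_endRankOne (hX : IsSmoothProjective n X.X) {T T' : AbelianVariety ℂ}
    (hT3 : T.dim = 3) (hTE : Module.finrank ℚ T.endAlgebra = 1) (hT'3 : T'.dim = 3) (hT'E : Module.finrank ℚ T'.endAlgebra = 1)
    (hTT' : ¬ IsIsogenous T T') (hXP : IsIsogenous X (T.prod T')) :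
    haveI := BettiUniverse.finite hX 1
    (BettiUniverse.hodge exists_isReal_hodgeModel_holds hX 1).mtRank = 43 := by
  have hT : IsSmoothProjective T.dim T.X := AbelianVariety.isSmoothProjective_holds
  haveI := BettiUniverse.finite hX 1
  haveI := BettiUniverse.finite hT 1
  obtain ⟨h22, -⟩ := mtRank_hodge_one_eq_twentytwo_of_threefold_of_finrank_endAlgebra_eq_one hT hT3 hTE
  have hHom : ∀ u : T ⟶ T', u = 0 := Literature.AlgebraicGeometry.Milne1999.hom_eq_zero_of_isSimple_of_not_isIsogenous
    (isSimple_of_threefold_of_finrank_endAlgebra_eq_one hT3 hTE) (isSimple_of_threefold_of_finrank_endAlgebra_eq_one hT'3 hT'E) hTT'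
  have h := mtRank_hodge_one_eq_add_of_isIsogenous_prod_threefold_endRankOne hX hT (by omega) hT'3 hT'E hHom hXP
  omega

end Summit.HodgeConjecture.CorCM

end
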